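/-
Copyright (c) 2026 the pub-hodgecm-mathlib formalisation cell (harness21).  Prover seat hodgecm-mathlib-K2E1-p14 (g3), Track B ∕ K2-LIT, h413 = `stmt-HodgeConjecture-24833`,
R90-TF section S8 «ContSpec-n½», socket #2 road (S8 dealer R90-CS-plan (g2) S8-R75 2026-09-04T22:51:23Z, regime (b) of census `CENSUS-D3.K2E1-p14-g3.md`): the density letter
(D₃) `hD : P ≤ (⨆ i, P ⊓ Iso i).topologicalClosure` of ★ F1_qs p862541 `residualG_le_topologicalClosure_of_letters(_quasiSplit)` at N = 3, in the K-TYPE currency of the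
NON-ABELIAN `K_∞ = U(J₃)(L⁺⊗ℝ) ∩ U(1⊗1)` — PAID LETTER-FREE from the tree's Peter–Weyl theorem and isotypic components.
-/
import Summits.HodgeConjecture.HodgeConjecture.Theorems.R90S8IsotypicDensityOfLettersU2    -- ★ p862396 (K2E2-p12): (D-fin) `le_topologicalClosure_iSup_inf_fix` (generic datum); brings ★ `isUnitary_rightRegular`, `isStronglyContinuous_rightRegular_holds`, `commute_archToAdelic_finAdelicToAdelic`
import Literature.NumberTheory.Automorphic.CompactGroupKFiniteVectorsPeterWeyl              -- ★ Peter–Weyl: `discretePart_eq_top_of_compactSpace` (every compact Hausdorff group)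
import Literature.NumberTheory.Automorphic.FiniteMultiplicityCriterion                      -- ★ `ClosedSubrep.areUnitarilyEquivalent_inflate`; brings ★ `ClosedSubrep.inflate`, `isTopIrreducible_inflate_iff`
import Literature.NumberTheory.Automorphic.HilbertRepIsotypicComponent                      -- ★ `ContRepresentation.isotypicComponent`, `le_isotypicComponent`
import Literature.NumberTheory.Automorphic.UnitaryGroupBorelSiegelSet                       -- ★ `mem_standardMaximalCompactGL_iff_toMixed_sndHom` (K₀ OF RECORD is open at N = 3)
import HarnessLib

/-!
# S8 #2 road, letter (D₃) — `R90S8ResGIsotypicDensityU3`: an irreducible closed subrepresentation `P` of `L²(U(J₃)(L⁺)∖U(J₃)(𝔸_{L⁺}))` lies in the closure of its pieces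
# `P ⊓ Fix(ι_f K′_f) ⊓ (the τ-isotypic component of `K_∞`)`, `K′_f ≤ K₀` open, `τ` a `K_∞`-type — the letter `hD` of ★ F1_qs p862541, K-TYPE currency, NO visible letter

Track B ∕ K2-LIT, crux h413 = `stmt-HodgeConjecture-24833`, route of record `HCCMUnconditional`; cell `hodgecm-mathlib`, R90-TF programme, section S8 «ContSpec-n½», socket #2
`sock_S8_res_classification` of `Lines/R90_S8_ResidualSpectrumU3B.lean` (via F1_qs ★ p862541 → F2 ★ `isOneDimensional_or_exists_isPiN`; after S8-R68 the (E) socket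
`sock_S8_res_exhaustion_le_closure`'s payment road).  THEOREMS ONLY (no `def`, no `instance`, no `notation`, no named-fact hypothesis, no `sorry`; default heartbeats); lane
`--supports stmt-HodgeConjecture-24833 --as helper` (count-neutral).  CLOSES NO SOCKET: it pays the letter (D₃) of ★ `residualG_le_topologicalClosure_of_letters_quasiSplit` at the index
family of record below; (HEAD₃)(E_blk,₃)(O₃)(N_blk,₃)(L₃) stay letters of that print.

THE REGIME (census (b), S8-R75): at N = 3 the archimedean compact `K_∞ ≅ U(2) × U(1)` (per place) is NOT abelian, so the N = 2 character currency (`ω : Kad(K′_f) →* ℂ`, ★ p862396, ★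
p862475) sees only the one-dimensional `K_∞`-types.  The index family OF RECORD for the G-side at N = 3 is therefore
`ι₃ := {K′_f ≤ K₀ open} × {U : ClosedSubrep ρ ∣ U irreducible}`, `ρ := R ∘ ι_∞ ∘ κ : K_∞ → U(L²)` (the unitary equivalence class `[U]` IS the `K_∞`-type; redundancy within a class is
harmless), with the `P`-INDEPENDENT, instance-free pieces `Iso (K′_f, U) := Fix(ι_f K′_f) ⊓ (ρ.isotypicComponent U.toContRep)` (★ `ContRepresentation.isotypicComponent`: the closed span
of the irreducible closed subrepresentations of `ρ` unitarily equivalent to `U`).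
THE MATHEMATICS ([BrockerTomDieck1985, III (5.7), Thm. (5.10)]; [DeitmarEchterhoff2014, Thm. 7.2.3, §7.3]; [BorelJacquet1979, §4.1, §4.6]; [MoeglinWaldspurger1995, I.2.18]).  (1) ★ (D-fin)
`le_topologicalClosure_iSup_inf_fix`: the `G(𝔸_f)`-smooth vectors of the irreducible `P` are dense, so `P ≤ closure ⨆_{K′_f ≤ K₀ open} P ⊓ Fix(ι_f K′_f)`.  (2) For each `K′_f`,
`V := P ⊓ Fix(ι_f K′_f)` is closed and `K_∞`-stable (`ι_∞` and `ι_f` commute, ★ `commute_archToAdelic_finAdelicToAdelic`), and `ρ_V` is a unitary strongly continuous representation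
of the COMPACT group `K_∞`; by PETER–WEYL (★ `discretePart_eq_top_of_compactSpace`, every compact Hausdorff group) `V` is the closed span of the irreducible closed subrepresentations
`U₀` of `ρ_V`; each inflates (★ `ClosedSubrep.inflate`) to an irreducible closed subrepresentation `U` of `ρ` (★ `isTopIrreducible_inflate_iff`) with `U ≤ V` and `U ≤
ρ.isotypicComponent U.toContRep` (★ `le_isotypicComponent`, reflexivity of unitary equivalence) — so `V ≤ closure ⨆_U (V ⊓ Iso-component)`.  (3) Two closure steps compose.  No
commutativity, injectivity or Lie structure of `K_∞` is used: §1–§2 hold for ANY compact Hausdorff group `K` mapped continuously into `U(J)(E ⊗ ℝ)`, any quadratic datum, rank and form.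
§3 instantiates at Mok's `U(J₃) = quasiSplit L⁺ L c 3` with the κ OF RECORD `Subgroup.inclusion inf_le_left : K_∞ ↪ U(J₃)(L⁺⊗ℝ)` (N = 3 twin of S8-R34; `K_∞` compact by §0, the
generic-`N` twin of ★ `K2E1BlockHeckeTBLetterFreeCMTwo.isCompact_archUnitaryPoints`) and ANY open `K₀`; §4 FED-BY at the K₀ OF RECORD `ι_f⁻¹(K_M1)` (open: the N = 3 twin of ★
`isOpen_comap_finAdelicToAdelic_maximalLevel`).
COST BOOKED FOR THE CHAIN (honest, not this file): (HEAD₃)∕(E_blk,₃) must be typed at THESE K-type pieces — sections with `e_τ φ = φ` (★ `Schur.charProj` =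
`(isotypicComponent τ).starProjection`, ★ `charProj_eq_starProjection_isotypicComponent`), not the character-typed `chiSectionSpacePair … K′ ω` of the E1 N = 3 twin rows.
* §0 `isCompact_arch_inf_unitaryOne`, `compactSpace_arch_inf_unitaryOne` (CM datum, every rank `N`, every form `H`), `continuous_inclusion_arch_inf_unitaryOne`.
* §1 **`le_topologicalClosure_iSup_inf_isotypicComponent_of_invariant`** — ABSTRACT: a closed stable subspace `W` of a unitary strongly continuous Hilbert representation of a compact
  Hausdorff group satisfies `W ≤ closure ⨆_{U irreducible} (W ⊓ isotypicComponent U)` (Peter–Weyl + inflation).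
* §2 **`le_topologicalClosure_iSup_inf_fix_inf_isotypicComponent`** — (D₃) on the generic datum `adelicGroupData F E c N J`, any compact `K`, `κ` continuous.
* §3 **`residualG_isotypic_density_kType_three`** — (D₃) at `quasiSplit L⁺ L c 3`, κ OF RECORD, any open `K₀` (★ F1_qs §3's `hD` at `Iso := fun i => Fix(ι_f i.1.1) ⊓ (ρ.isotypicComponent i.2.1.toContRep)`).
* §4 `isOpen_comap_finAdelicToAdelic_maximalLevel_three`, `residualG_isotypic_density_kType_three_maximalLevel` (FED-BY at the K₀ OF RECORD).
HONEST LABEL: HC_CM is proved only modulo the 7 printed citations (2 remaining named inputs: hLiu418 = `stmt-HodgeConjecture-24832`, h413 = `stmt-HodgeConjecture-24833`) until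
rung 0 closes; REL ≠ ★ ≠ BUILT; this file asserts no named fact and closes no socket ((D₃) is a letter of socket (E)'s road); count-neutral.

## References
* [BrockerTomDieck1985] T. Bröcker, T. tom Dieck, *Representations of Compact Lie Groups*, GTM 98 (1985), III (5.7), Thm. (5.10).
* [DeitmarEchterhoff2014] A. Deitmar, S. Echterhoff, *Principles of Harmonic Analysis* (2nd ed., 2014), Thm. 7.2.3, §7.3.
* [BorelJacquet1979] A. Borel, H. Jacquet, *Automorphic forms and automorphic representations*, Corvallis PSPM 33.1 (1979), §4.1, §4.6.
* [MoeglinWaldspurger1995] C. Mœglin, J.-L. Waldspurger, *Spectral Decomposition and Eisenstein Series* (1995), I.2.18.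
-/

set_option autoImplicit false
set_option linter.dupNamespace false  -- the mandated namespace `…HodgeConjecture.HodgeConjecture.R90.S8` (LEAD #1 L1) repeats the summit's segment

noncomputable section

open MeasureTheory Measure Set Filter Topology NumberField NumberField.mixedEmbedding IsDedekindDomain
open Literature.NumberTheory.Automorphic Literature.NumberTheory.Automorphic.UnitaryGroup AdelicGroupData ContRepresentation
open scoped ENNReal NNReal ComplexOrder

namespace Summit.HodgeConjecture.HodgeConjecture.R90.S8

/-! ## §0 `K_∞ = U(H)(L⁺ ⊗ ℝ) ∩ U(1 ⊗ 1)` is compact (CM datum, every rank), and its inclusion is continuous -/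

section KInfCompact

variable (L : Type) [Field L] [NumberField L] [IsCMField L] (N : ℕ) (H : Matrix (Fin N) (Fin N) L)

/-- **`K_∞ = U(H)(L⁺⊗ℝ) ∩ U(1⊗1)` IS COMPACT** (every rank `N`, every form `H`; the generic-`N` twin of ★ `isCompact_archUnitaryPoints`): `U(1_N)(L⁺⊗ℝ) = ∏_w U(N)` is compact (★
`isCompact_arch` at the definite form `1`; every infinite place of the CM field `L` is fixed by `c ≠ 1`) and `U(H)(L⁺⊗ℝ)` is closed (★ `isClosed_arch`). [cite: BorelJacquet1979, §4.1] -/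
theorem isCompact_arch_inf_unitaryOne :
    IsCompact ((UnitaryGroup.arch (↥(maximalRealSubfield L)) L (IsCMField.complexConj L) N H ⊓ unitaryGroupOfForm (conjMixed (↥(maximalRealSubfield L)) L (IsCMField.complexConj L)) 1 :
      Subgroup (GL (Fin N) (mixedSpace L))) : Set (GL (Fin N) (mixedSpace L))) := by
  have h1 : unitaryGroupOfForm (conjMixed (↥(maximalRealSubfield L)) L (IsCMField.complexConj L)) (1 : Matrix (Fin N) (Fin N) (mixedSpace L)) =
      UnitaryGroup.arch (↥(maximalRealSubfield L)) L (IsCMField.complexConj L) N (1 : Matrix (Fin N) (Fin N) L) := by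
    change _ = unitaryGroupOfForm _ (archFormOf L N (1 : Matrix (Fin N) (Fin N) L))
    rw [show archFormOf L N (1 : Matrix (Fin N) (Fin N) L) = 1 from Matrix.map_one _ (map_zero _) (map_one _)]
  have hK1 : IsCompact ((UnitaryGroup.arch (↥(maximalRealSubfield L)) L (IsCMField.complexConj L) N (1 : Matrix (Fin N) (Fin N) L) :
      Subgroup (GL (Fin N) (mixedSpace L))) : Set (GL (Fin N) (mixedSpace L))) :=
    isCompact_arch (↥(maximalRealSubfield L)) L (IsCMField.complexConj L) N (1 : Matrix (Fin N) (Fin N) L) (IsCMField.complexConj_ne_one L)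
      (complexConj_smul_infinitePlace L) fun w => Or.inl (by rw [Matrix.map_one _ (map_zero _) (map_one _)]; exact Matrix.PosDef.one)
  rw [Subgroup.coe_inf, h1]
  exact hK1.inter_left (isClosed_arch (↥(maximalRealSubfield L)) L (IsCMField.complexConj L) N H)

/-- `K_∞` as a compact space. [cite: BorelJacquet1979, §4.1] -/
theorem compactSpace_arch_inf_unitaryOne :
    CompactSpace ↥(UnitaryGroup.arch (↥(maximalRealSubfield L)) L (IsCMField.complexConj L) N H ⊓ unitaryGroupOfForm (conjMixed (↥(maximalRealSubfield L)) L (IsCMField.complexConj L)) 1) :=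
  isCompact_iff_compactSpace.mp (isCompact_arch_inf_unitaryOne L N H)

/-- The inclusion `K_∞ ↪ U(H)(L⁺ ⊗ ℝ)` is continuous (subspace topologies). [folklore] -/
theorem continuous_inclusion_arch_inf_unitaryOne :
    Continuous (Subgroup.inclusion (inf_le_left : UnitaryGroup.arch (↥(maximalRealSubfield L)) L (IsCMField.complexConj L) N H ⊓ unitaryGroupOfForm (conjMixed (↥(maximalRealSubfield L)) L (IsCMField.complexConj L)) 1 ≤
      UnitaryGroup.arch (↥(maximalRealSubfield L)) L (IsCMField.complexConj L) N H)) :=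
  continuous_induced_rng.2 continuous_subtype_val

end KInfCompact

/-! ## §1 Abstract: a closed stable subspace lies in the closure of its isotypic pieces (Peter–Weyl, every compact Hausdorff group) -/

section Abstract

variable {C : Type*} [Group C] [TopologicalSpace C] [IsTopologicalGroup C] [CompactSpace C] [T2Space C]
  {V : Type*} [NormedAddCommGroup V] [InnerProductSpace ℂ V] [CompleteSpace V]

/-- **ISOTYPIC DENSITY ON A CLOSED STABLE SUBSPACE, NON-ABELIAN**: `σ` a unitary strongly continuous representation of the compact Hausdorff group `C` on the Hilbert space `V`, `W ≤ V`
CLOSED and `σ`-STABLE.  Then `W ≤ closure ⨆_{U} (W ⊓ σ.isotypicComponent U.toContRep)`, `U` ranging over the irreducible closed subrepresentations of `σ`: the subrepresentation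
`W.toContRep` is the closed span of its irreducible closed subrepresentations `U₀` (★ Peter–Weyl `discretePart_eq_top_of_compactSpace`), each inflates to an irreducible `U = W.inflate U₀`
of `σ` (★ `isTopIrreducible_inflate_iff`) inside `W` and inside `σ.isotypicComponent U.toContRep` (★ `le_isotypicComponent`); push through the continuous inclusion `↥W → V`.
[cite: BrockerTomDieck1985, III (5.7), Thm. (5.10)] [cite: DeitmarEchterhoff2014, Thm. 7.2.3, §7.3] -/
theorem le_topologicalClosure_iSup_inf_isotypicComponent_of_invariant {σ : ContRepresentation ℂ C V} (hσ : σ.IsUnitary) (hsc : σ.IsStronglyContinuous)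
    (W : Submodule ℂ V) (hWc : IsClosed (W : Set V)) (hWinv : ∀ (c : C), ∀ v ∈ W, σ c v ∈ W) :
    W ≤ (⨆ U : {U : ClosedSubrep σ // U.toContRep.IsTopIrreducible}, W ⊓ (σ.isotypicComponent U.1.toContRep).toSubmodule).topologicalClosure := by
  -- `W` as a closed subrepresentation; its representation is unitary and strongly continuous
  let W' : ClosedSubrep σ := { toSubmodule := W, apply_mem_toSubmodule := fun c v hv => hWinv c v hv, isClosed' := hWc }
  have hρ : W'.toContRep.IsUnitary := ClosedSubrep.isUnitary_toContRep hσ W'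
  have hρsc : W'.toContRep.IsStronglyContinuous := fun v => by
    refine continuous_induced_rng.2 ?_
    have h : (Subtype.val ∘ fun c : C => W'.toContRep c v) = fun c : C => σ c (v : V) := by
      funext c
      rfl
    rw [h]
    exact hsc (v : V)
  -- Peter–Weyl: `W.toContRep` is the closed span of its irreducible closed subrepresentations
  have htop : W'.toContRep.discretePart = ⊤ := discretePart_eq_top_of_compactSpace hρsc hρ
  -- their images in `V` (inflations) lie in the target
  have hmap : Submodule.map W'.toSubmodule.subtype (⨆ U₀ ∈ {U₀ : ClosedSubrep W'.toContRep | U₀.toContRep.IsTopIrreducible}, (U₀ : ClosedSubrep W'.toContRep).toSubmodule) ≤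
      ⨆ U : {U : ClosedSubrep σ // U.toContRep.IsTopIrreducible}, W ⊓ (σ.isotypicComponent U.1.toContRep).toSubmodule := by
    rw [Submodule.map_iSup]
    refine iSup_le fun U₀ => ?_
    rw [Submodule.map_iSup]
    refine iSup_le fun hU₀ => ?_
    have hirr : (W'.inflate U₀).toContRep.IsTopIrreducible := (W'.isTopIrreducible_inflate_iff U₀).2 hU₀
    have hiso : W'.inflate U₀ ≤ σ.isotypicComponent (W'.inflate U₀).toContRep := ContRepresentation.le_isotypicComponent hirr (AreUnitarilyEquivalent.refl _)
    refine le_trans ?_ (le_iSup (fun U : {U : ClosedSubrep σ // U.toContRep.IsTopIrreducible} => W ⊓ (σ.isotypicComponent U.1.toContRep).toSubmodule) ⟨W'.inflate U₀, hirr⟩)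
    refine le_inf ?_ fun x hx => hiso hx
    rintro _ ⟨y, -, rfl⟩
    exact y.2
  -- push the density through the continuous inclusion `↥W → V`
  intro v hv
  have hy : (⟨v, hv⟩ : W'.toSubmodule) ∈ W'.toContRep.discretePart := by
    rw [htop]
    exact ClosedSubrep.mem_top _
  change (⟨v, hv⟩ : W'.toSubmodule) ∈ (⨆ U₀ ∈ {U₀ : ClosedSubrep W'.toContRep | U₀.toContRep.IsTopIrreducible}, (U₀ : ClosedSubrep W'.toContRep).toSubmodule).topologicalClosure at hy
  rw [← SetLike.mem_coe, Submodule.topologicalClosure_coe] at hy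
  have himg := image_closure_subset_closure_image continuous_subtype_val (mem_image_of_mem Subtype.val hy)
  rw [← SetLike.mem_coe, Submodule.topologicalClosure_coe]
  refine closure_mono ?_ himg
  rintro _ ⟨y, hyS, rfl⟩
  exact hmap (Submodule.mem_map_of_mem hyS)

end Abstract

/-! ## §2 (D₃) on the generic datum: `P ≤ closure ⨆_{(K′_f, U)} P ⊓ Fix(ι_f K′_f) ⊓ Iso_U`, any compact `K` read in `U(J)(E ⊗ ℝ)` -/

section Adelic

variable {F E : Type} [Field F] [NumberField F] [Field E] [NumberField E] [Algebra F E] {c : E ≃ₐ[F] E} {N : ℕ} {J : Matrix (Fin N) (Fin N) E}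
  (μ : Measure (adelicGroupData F E c N J).automorphicQuotient) [(adelicGroupData F E c N J).IsAutomorphicMeasure μ]
  {K : Type*} [Group K] [TopologicalSpace K] [IsTopologicalGroup K] [CompactSpace K] [T2Space K] (κ : K →* arch F E c N J)

/-- **(D₃) — K-TYPE ISOTYPIC DENSITY, GENERIC DATUM, NO LETTER**: for an irreducible closed `P ≤ L²(U(J)(F)∖U(J)(𝔸_F))`, an OPEN `K₀ ≤ U(J)(𝔸_{F,f})` and ANY compact Hausdorff group `K` with
a CONTINUOUS `κ : K →* U(J)(E ⊗ ℝ)` (no commutativity, no injectivity): `P ≤ closure ⨆_{(K′_f, U)} P ⊓ Fix(ι_f K′_f) ⊓ ρ.isotypicComponent U`, `K′_f ≤ K₀` open, `U` an irreducible closed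
subrepresentation of `ρ = R ∘ ι_∞ ∘ κ`.  ★ (D-fin) `le_topologicalClosure_iSup_inf_fix` ∘ §1 on `P ⊓ Fix(ι_f K′_f)` (closed; `K`-stable by ★ `commute_archToAdelic_finAdelicToAdelic`; `R` unitary ★
`isUnitary_rightRegular`, strongly continuous ★ `isStronglyContinuous_rightRegular_holds` + ★ `continuous_archToAdelic`) ∘ two closure steps.
[cite: BorelJacquet1979, §4.1, §4.6] [cite: BrockerTomDieck1985, III (5.7)] [cite: MoeglinWaldspurger1995, I.2.18] -/
theorem le_topologicalClosure_iSup_inf_fix_inf_isotypicComponent (hκc : Continuous κ) (P : ClosedSubrep ((adelicGroupData F E c N J).rightRegular μ)) (hP : P.toContRep.IsTopIrreducible)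
    (K₀ : Subgroup (finAdelic F E c N J)) (hK₀ : IsOpen (K₀ : Set (finAdelic F E c N J))) :
    P.toSubmodule ≤ (⨆ i : {Kf : Subgroup (finAdelic F E c N J) // IsOpen (Kf : Set (finAdelic F E c N J)) ∧ Kf ≤ K₀} × {U : ClosedSubrep (((adelicGroupData F E c N J).rightRegular μ).restrict ((archToAdelic F E c N J).comp κ)) // U.toContRep.IsTopIrreducible},
      P.toSubmodule ⊓ (⨅ u : ↥(i.1.1), Module.End.eigenspace ((((adelicGroupData F E c N J).rightRegular μ) (finAdelicToAdelic F E c N J (u : finAdelic F E c N J)) :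
        (adelicGroupData F E c N J).L2 μ →L[ℂ] (adelicGroupData F E c N J).L2 μ) : (adelicGroupData F E c N J).L2 μ →ₗ[ℂ] (adelicGroupData F E c N J).L2 μ) 1) ⊓ (((((adelicGroupData F E c N J).rightRegular μ).restrict ((archToAdelic F E c N J).comp κ))).isotypicComponent i.2.1.toContRep).toSubmodule).topologicalClosure := by
  have hU := (adelicGroupData F E c N J).isUnitary_rightRegular μ
  have hS := (adelicGroupData F E c N J).isStronglyContinuous_rightRegular_holds μ
  -- (1) density of the `G(𝔸_f)`-smooth vectors
  have h1 := le_topologicalClosure_iSup_inf_fix μ P hP K₀ hK₀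
  -- (2) Peter–Weyl on each closed `K`-stable piece `P ⊓ Fix(ι_f K′_f)`
  have h2 : ∀ Kf : {Kf : Subgroup (finAdelic F E c N J) // IsOpen (Kf : Set (finAdelic F E c N J)) ∧ Kf ≤ K₀},
      P.toSubmodule ⊓ (⨅ u : ↥(Kf.1), Module.End.eigenspace ((((adelicGroupData F E c N J).rightRegular μ) (finAdelicToAdelic F E c N J (u : finAdelic F E c N J)) :
        (adelicGroupData F E c N J).L2 μ →L[ℂ] (adelicGroupData F E c N J).L2 μ) : (adelicGroupData F E c N J).L2 μ →ₗ[ℂ] (adelicGroupData F E c N J).L2 μ) 1) ≤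
        (⨆ U : {U : ClosedSubrep (((adelicGroupData F E c N J).rightRegular μ).restrict ((archToAdelic F E c N J).comp κ)) // U.toContRep.IsTopIrreducible},
          (P.toSubmodule ⊓ (⨅ u : ↥(Kf.1), Module.End.eigenspace ((((adelicGroupData F E c N J).rightRegular μ) (finAdelicToAdelic F E c N J (u : finAdelic F E c N J)) :
        (adelicGroupData F E c N J).L2 μ →L[ℂ] (adelicGroupData F E c N J).L2 μ) : (adelicGroupData F E c N J).L2 μ →ₗ[ℂ] (adelicGroupData F E c N J).L2 μ) 1)) ⊓ (((((adelicGroupData F E c N J).rightRegular μ).restrict ((archToAdelic F E c N J).comp κ))).isotypicComponent U.1.toContRep).toSubmodule).topologicalClosure := by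
    intro Kf
    refine le_topologicalClosure_iSup_inf_isotypicComponent_of_invariant (σ := (((adelicGroupData F E c N J).rightRegular μ).restrict ((archToAdelic F E c N J).comp κ))) (fun k => hU _) (fun v => (hS v).comp ((continuous_archToAdelic F E c N J).comp hκc)) _ ?_ ?_
    · -- closed
      rw [Submodule.coe_inf, Submodule.coe_iInf]
      exact P.isClosed.inter (isClosed_iInter fun u => ContinuousLinearMap.isClosed_eigenspace _ _)
    · -- `K`-stable: `R(ι_f u) (R(ι_∞κk) v) = R(ι_∞κk) (R(ι_f u) v) = R(ι_∞κk) v`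
      rintro k v ⟨hvP, hvFix⟩
      refine ⟨P.apply_mem _ hvP, (Submodule.mem_iInf _).2 fun u => Module.End.mem_eigenspace_iff.2 ?_⟩
      have hu : ((adelicGroupData F E c N J).rightRegular μ) (finAdelicToAdelic F E c N J (u : finAdelic F E c N J)) v = v :=
        (Module.End.mem_eigenspace_iff.1 ((Submodule.mem_iInf _).1 hvFix u)).trans (one_smul ℂ v)
      rw [one_smul, ContinuousLinearMap.coe_coe, ContRepresentation.restrict_apply, MonoidHom.coe_comp, Function.comp_apply]
      change (((adelicGroupData F E c N J).rightRegular μ) (finAdelicToAdelic F E c N J (u : finAdelic F E c N J)) * ((adelicGroupData F E c N J).rightRegular μ) (archToAdelic F E c N J (κ k))) v =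
        ((adelicGroupData F E c N J).rightRegular μ) (archToAdelic F E c N J (κ k)) v
      rw [← map_mul ((adelicGroupData F E c N J).rightRegular μ), ← (commute_archToAdelic_finAdelicToAdelic F E c N J (κ k) (u : finAdelic F E c N J)).eq, map_mul]
      change ((adelicGroupData F E c N J).rightRegular μ) (archToAdelic F E c N J (κ k)) (((adelicGroupData F E c N J).rightRegular μ) (finAdelicToAdelic F E c N J (u : finAdelic F E c N J)) v) = _
      rw [hu]
  -- (3) two closure steps compose
  refine h1.trans (Submodule.topologicalClosure_minimal _ (iSup_le fun Kf => (h2 Kf).trans (Submodule.topologicalClosure_mono (iSup_le fun U => ?_))) (Submodule.isClosed_topologicalClosure _))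
  exact le_iSup (fun i : {Kf : Subgroup (finAdelic F E c N J) // IsOpen (Kf : Set (finAdelic F E c N J)) ∧ Kf ≤ K₀} × {U : ClosedSubrep (((adelicGroupData F E c N J).rightRegular μ).restrict ((archToAdelic F E c N J).comp κ)) // U.toContRep.IsTopIrreducible} =>
    P.toSubmodule ⊓ (⨅ u : ↥(i.1.1), Module.End.eigenspace ((((adelicGroupData F E c N J).rightRegular μ) (finAdelicToAdelic F E c N J (u : finAdelic F E c N J)) :
        (adelicGroupData F E c N J).L2 μ →L[ℂ] (adelicGroupData F E c N J).L2 μ) : (adelicGroupData F E c N J).L2 μ →ₗ[ℂ] (adelicGroupData F E c N J).L2 μ) 1) ⊓ (((((adelicGroupData F E c N J).rightRegular μ).restrict ((archToAdelic F E c N J).comp κ))).isotypicComponent i.2.1.toContRep).toSubmodule) (Kf, U)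

end Adelic

/-! ## §3 (D₃) at Mok's `U(J₃) = quasiSplit L⁺ L c 3`, κ OF RECORD `K_∞ ↪ U(J₃)(L⁺ ⊗ ℝ)`, any open `K₀` -/

section CMThree

variable (L : Type) [Field L] [NumberField L] [IsCMField L]
  (μ : Measure (quasiSplit (↥(maximalRealSubfield L)) L (IsCMField.complexConj L) 3).automorphicQuotient) [(quasiSplit (↥(maximalRealSubfield L)) L (IsCMField.complexConj L) 3).IsAutomorphicMeasure μ]

/-- **(D₃) AT `U(J₃)_{L∕L⁺}` — THE LETTER `hD` OF ★ `residualG_le_topologicalClosure_of_letters_quasiSplit`** at the index family OF RECORD `ι₃ = {K′_f ≤ K₀ open} × {U irreducible closed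
subrepresentation of ρ = R ∘ ι_∞|_{K_∞}}`, `Iso (K′_f, U) := Fix(ι_f K′_f) ⊓ ρ.isotypicComponent U.toContRep` (`K_∞ = U(J₃)(L⁺⊗ℝ) ∩ U(1⊗1) ≅ U(2) × U(1)`, non-abelian; compact §0): for every
irreducible closed `P` and every open `K₀`, `P ≤ closure ⨆_{i ∈ ι₃} P ⊓ Iso i` — §2 at the κ OF RECORD.  No letter. [cite: BrockerTomDieck1985, III (5.7), Thm. (5.10)] [cite: BorelJacquet1979, §4.1, §4.6] -/
theorem residualG_isotypic_density_kType_three (P : ClosedSubrep ((quasiSplit (↥(maximalRealSubfield L)) L (IsCMField.complexConj L) 3).rightRegular μ)) (hP : P.toContRep.IsTopIrreducible)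
    (K₀ : Subgroup ↥(finAdelic (↥(maximalRealSubfield L)) L (IsCMField.complexConj L) 3 ((StdForm.antidiagonal 3).over L))) (hK₀ : IsOpen ((K₀ : Subgroup ↥(finAdelic (↥(maximalRealSubfield L)) L (IsCMField.complexConj L) 3 ((StdForm.antidiagonal 3).over L))) : Set ↥(finAdelic (↥(maximalRealSubfield L)) L (IsCMField.complexConj L) 3 ((StdForm.antidiagonal 3).over L)))) :
    P.toSubmodule ≤ (⨆ i : {Kf : Subgroup ↥(finAdelic (↥(maximalRealSubfield L)) L (IsCMField.complexConj L) 3 ((StdForm.antidiagonal 3).over L)) // IsOpen ((Kf : Subgroup ↥(finAdelic (↥(maximalRealSubfield L)) L (IsCMField.complexConj L) 3 ((StdForm.antidiagonal 3).over L))) : Set ↥(finAdelic (↥(maximalRealSubfield L)) L (IsCMField.complexConj L) 3 ((StdForm.antidiagonal 3).over L))) ∧ Kf ≤ K₀} × {U : ClosedSubrep (((quasiSplit (↥(maximalRealSubfield L)) L (IsCMField.complexConj L) 3).rightRegular μ).restrict ((archToAdelic (↥(maximalRealSubfield L)) L (IsCMField.complexConj L) 3 ((StdForm.antidiagonal 3).over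 L)).comp (Subgroup.inclusion (inf_le_left : (UnitaryGroup.arch (↥(maximalRealSubfield L)) L (IsCMField.complexConj L) 3 ((StdForm.antidiagonal 3).over L) ⊓ unitaryGroupOfForm (conjMixed (↥(maximalRealSubfield L)) L (IsCMField.complexConj L)) 1) ≤ UnitaryGroup.arch (↥(maximalRealSubfield L)) L (IsCMField.complexConj L) 3 ((StdForm.antidiagonal 3).over L))))) // U.toContRep.IsTopIrreducible},
      P.toSubmodule ⊓ (⨅ u : ↥(i.1.1), Module.End.eigenspace ((((quasiSplit (↥(maximalRealSubfield L)) L (IsCMField.complexConj L) 3).rightRegular μ) (finAdelicToAdelic (↥(maximalRealSubfield L)) L (IsCMField.complexConj L) 3 ((StdForm.antidiagonal 3).over L) (u : ↥(finAdelic (↥(maximalRealSubfield L)) L (IsCMField.complexConj L) 3 ((StdForm.antidiagonal 3).over L)))) :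
        (quasiSplit (↥(maximalRealSubfield L)) L (IsCMField.complexConj L) 3).L2 μ →L[ℂ] (quasiSplit (↥(maximalRealSubfield L)) L (IsCMField.complexConj L) 3).L2 μ) : (quasiSplit (↥(maximalRealSubfield L)) L (IsCMField.complexConj L) 3).L2 μ →ₗ[ℂ] (quasiSplit (↥(maximalRealSubfield L)) L (IsCMField.complexConj L) 3).L2 μ) 1) ⊓ (((((quasiSplit (↥(maximalRealSubfield L)) L (IsCMField.complexConj L) 3).rightRegular μ).restrict ((archToAdelic (↥(maximalRealSubfield L)) L (IsCMField.complexConj L) 3 ((StdForm.antidiagonal 3).over L)).comp (Subgroup.inclusion (inf_le_left : (UnitaryGroup.arch (↥(maximalRealSubfield L)) L (IsCMField.complexConj L) 3 ((StdForm.antidiagonal 3).over L) ⊓ unitaryGroupOfForm (conjMixed (↥(maximalRealSubfield L)) L (IsCMField.complexConj L)) 1) ≤ UnitaryGroup.arch (↥(maximalRealSubfield L)) L (IsCMField.complexConj L) 3 ((StdForm.antidiagonal 3).over L)))))).isotypicComponent i.2.1.toContRep).toSubmodule).topologicalClosure := by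
  haveI : CompactSpace ↥(UnitaryGroup.arch (↥(maximalRealSubfield L)) L (IsCMField.complexConj L) 3 ((StdForm.antidiagonal 3).over L) ⊓ unitaryGroupOfForm (conjMixed (↥(maximalRealSubfield L)) L (IsCMField.complexConj L)) 1) := compactSpace_arch_inf_unitaryOne L 3 ((StdForm.antidiagonal 3).over L)
  exact le_topologicalClosure_iSup_inf_fix_inf_isotypicComponent μ (Subgroup.inclusion (inf_le_left : (UnitaryGroup.arch (↥(maximalRealSubfield L)) L (IsCMField.complexConj L) 3 ((StdForm.antidiagonal 3).over L) ⊓ unitaryGroupOfForm (conjMixed (↥(maximalRealSubfield L)) L (IsCMField.complexConj L)) 1) ≤ UnitaryGroup.arch (↥(maximalRealSubfield L)) L (IsCMField.complexConj L) 3 ((StdForm.antidiagonal 3).over L))) (continuous_inclusion_arch_inf_unitaryOne L 3 ((StdForm.antidiagonal 3).over L)) P hP K₀ hK₀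

/-! ## §4 FED-BY (chair R39): the K₀ OF RECORD `ι_f⁻¹(K_M1)` is open at N = 3, and the head reads there -/

/-- **THE K₀ OF RECORD AT N = 3 IS OPEN**: the finite trace of `K_M1 = adelicVal⁻¹(K_∞·GL₃(𝒪̂_L))` is `U(J₃)(𝔸_f) ∩ GL₃(𝒪̂_L)` (★ `mem_standardMaximalCompactGL_iff_toMixed_sndHom`, ★
`isOpen_glFiniteIntegralLevel`; the N = 3 twin of ★ `isOpen_comap_finAdelicToAdelic_maximalLevel`). [cite: BorelJacquet1979, §4.1] -/
theorem isOpen_comap_finAdelicToAdelic_maximalLevel_three : IsOpen ((((((standardMaximalCompactGL 3 L).comap (adelicVal (↥(maximalRealSubfield L)) L (IsCMField.complexConj L) 3 ((StdForm.antidiagonal 3).over L)) : Subgroup (quasiSplit (↥(maximalRealSubfield L)) L (IsCMField.complexConj L) 3).Adelic)).comap (finAdelicToAdelic (↥(maximalRealSubfield L)) L (IsCMField.complexConj L) 3 ((StdForm.antidiagonal 3).over L)) : Subgroup ↥(finAdelic (↥(maximalRealSubfield L)) L (IsCMField.complexConj L) 3 ((StdForm.antidiagonal 3).over L)))) : Set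 ↥(finAdelic (↥(maximalRealSubfield L)) L (IsCMField.complexConj L) 3 ((StdForm.antidiagonal 3).over L))) := by
  have hset : ((((((standardMaximalCompactGL 3 L).comap (adelicVal (↥(maximalRealSubfield L)) L (IsCMField.complexConj L) 3 ((StdForm.antidiagonal 3).over L)) : Subgroup (quasiSplit (↥(maximalRealSubfield L)) L (IsCMField.complexConj L) 3).Adelic)).comap (finAdelicToAdelic (↥(maximalRealSubfield L)) L (IsCMField.complexConj L) 3 ((StdForm.antidiagonal 3).over L)) : Subgroup ↥(finAdelic (↥(maximalRealSubfield L)) L (IsCMField.complexConj L) 3 ((StdForm.antidiagonal 3).over L)))) : Set ↥(finAdelic (↥(maximalRealSubfield L)) L (IsCMField.complexConj L) 3 ((StdForm.antidiagonal 3).over L))) = Subtype.val ⁻¹' (glFiniteIntegralLevel 3 L : Set (GL (Fin 3) (FiniteAdeleRing (𝓞 L) L))) := by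
    ext u
    rw [SetLike.mem_coe, Subgroup.mem_comap, Subgroup.mem_comap, adelicVal_finAdelicToAdelic, mem_standardMaximalCompactGL_iff_toMixed_sndHom, GLn.toMixed_ofFinite,
      GLn.sndHom_ofFinite, Set.mem_preimage, SetLike.mem_coe]
    exact ⟨fun h => h.2, fun h => ⟨(Kinf 3 L).one_mem, h⟩⟩
  rw [hset]
  exact (isOpen_glFiniteIntegralLevel 3 L).preimage continuous_subtype_val

/-- **(D₃) AT THE K₀ OF RECORD** (FED-BY: §3's `K₀ hK₀` instantiated; every irreducible closed `P`). [cite: BrockerTomDieck1985, III (5.7)] [cite: BorelJacquet1979, §4.1] -/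
theorem residualG_isotypic_density_kType_three_maximalLevel (P : ClosedSubrep ((quasiSplit (↥(maximalRealSubfield L)) L (IsCMField.complexConj L) 3).rightRegular μ)) (hP : P.toContRep.IsTopIrreducible) :
    P.toSubmodule ≤ (⨆ i : {Kf : Subgroup ↥(finAdelic (↥(maximalRealSubfield L)) L (IsCMField.complexConj L) 3 ((StdForm.antidiagonal 3).over L)) // IsOpen ((Kf : Subgroup ↥(finAdelic (↥(maximalRealSubfield L)) L (IsCMField.complexConj L) 3 ((StdForm.antidiagonal 3).over L))) : Set ↥(finAdelic (↥(maximalRealSubfield L)) L (IsCMField.complexConj L) 3 ((StdForm.antidiagonal 3).over L))) ∧ Kf ≤ ((((standardMaximalCompactGL 3 L).comap (adelicVal (↥(maximalRealSubfield L)) L (IsCMField.complexConj L) 3 ((StdForm.antidiagonal 3).over L)) : Subgroup (quasiSplit (↥(maximalRealSubfield L)) L (IsCMField.complexConj L) 3).Adelic)).comap (finAdelicToAdelic (↥(maximalRealSubfield L)) L (IsCMField.complexConj L) 3 ((StdForm.antidiagonal 3).over L)) : Subgroup ↥(finAdelic (↥(maximalRealSubfield L)) L (IsCMField.complexConj L)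 3 ((StdForm.antidiagonal 3).over L)))} × {U : ClosedSubrep (((quasiSplit (↥(maximalRealSubfield L)) L (IsCMField.complexConj L) 3).rightRegular μ).restrict ((archToAdelic (↥(maximalRealSubfield L)) L (IsCMField.complexConj L) 3 ((StdForm.antidiagonal 3).over L)).comp (Subgroup.inclusion (inf_le_left : (UnitaryGroup.arch (↥(maximalRealSubfield L)) L (IsCMField.complexConj L) 3 ((StdForm.antidiagonal 3).over L) ⊓ unitaryGroupOfForm (conjMixed (↥(maximalRealSubfield L)) L (IsCMField.complexConj L)) 1) ≤ UnitaryGroup.arch (↥(maximalRealSubfield L)) L (IsCMField.complexConj L) 3 ((StdForm.antidiagonal 3).over L))))) // U.toContRep.IsTopIrreducible},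
      P.toSubmodule ⊓ (⨅ u : ↥(i.1.1), Module.End.eigenspace ((((quasiSplit (↥(maximalRealSubfield L)) L (IsCMField.complexConj L) 3).rightRegular μ) (finAdelicToAdelic (↥(maximalRealSubfield L)) L (IsCMField.complexConj L) 3 ((StdForm.antidiagonal 3).over L) (u : ↥(finAdelic (↥(maximalRealSubfield L)) L (IsCMField.complexConj L) 3 ((StdForm.antidiagonal 3).over L)))) :
        (quasiSplit (↥(maximalRealSubfield L)) L (IsCMField.complexConj L) 3).L2 μ →L[ℂ] (quasiSplit (↥(maximalRealSubfield L)) L (IsCMField.complexConj L) 3).L2 μ) : (quasiSplit (↥(maximalRealSubfield L)) L (IsCMField.complexConj L) 3).L2 μ →ₗ[ℂ] (quasiSplit (↥(maximalRealSubfield L)) L (IsCMField.complexConj L) 3).L2 μ) 1) ⊓ (((((quasiSplit (↥(maximalRealSubfield L)) L (IsCMField.complexConj L) 3).rightRegular μ).restrict ((archToAdelic (↥(maximalRealSubfield L)) L (IsCMField.complexConj L) 3 ((StdForm.antidiagonal 3).over L)).comp (Subgroup.inclusion (inf_le_left : (UnitaryGroup.arch (↥(maximalRealSubfield L)) L (IsCMField.complexConj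 L) 3 ((StdForm.antidiagonal 3).over L) ⊓ unitaryGroupOfForm (conjMixed (↥(maximalRealSubfield L)) L (IsCMField.complexConj L)) 1) ≤ UnitaryGroup.arch (↥(maximalRealSubfield L)) L (IsCMField.complexConj L) 3 ((StdForm.antidiagonal 3).over L)))))).isotypicComponent i.2.1.toContRep).toSubmodule).topologicalClosure :=
  residualG_isotypic_density_kType_three L μ P hP (((((standardMaximalCompactGL 3 L).comap (adelicVal (↥(maximalRealSubfield L)) L (IsCMField.complexConj L) 3 ((StdForm.antidiagonal 3).over L)) : Subgroup (quasiSplit (↥(maximalRealSubfield L)) L (IsCMField.complexConj L) 3).Adelic)).comap (finAdelicToAdelic (↥(maximalRealSubfield L)) L (IsCMField.complexConj L) 3 ((StdForm.antidiagonal 3).over L)) : Subgroup ↥(finAdelic (↥(maximalRealSubfield L)) L (IsCMField.complexConj L) 3 ((StdForm.antidiagonal 3).over L)))) (isOpen_comap_finAdelicToAdelic_maximalLevel_three L)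

end CMThree

end Summit.HodgeConjecture.HodgeConjecture.R90.S8

end
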